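import Literature.NumberTheory.GaloisRepresentations.ArtinReciprocityCharacterFiniteProofs
import HarnessLib

/-!
# Unramified primes in composita and subfields of finite Galois extensions inside `K̄`

Topic `NumberTheory/NumberFields`.  Theorem-only file (no definition, no named fact, D-0026).

For finite Galois subextensions `E₁, E₂, L, L'` of `K̄ = AlgebraicClosure K` over a number field
`K` and a finite place `v` of `K`:

* `isUnramifiedIn_iff_forall_inertia_absRestrictNormalHom_eq_one` — **`v` is unramified in `L`
  iff every inertia group `I_𝔓 ≤ Γ_K` (`𝔓 ∣ v` a prime of `\bar ℤ_K`) dies in `Gal(L/K)`**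
  (Neukirch, *Algebraic Number Theory*, VII §10, proof of (10.6): "`𝔭` is ramified `⟺ I_𝔓 ≠ 1`";
  assembled from the tree's `absRestrictNormalHom_eq_one_of_isUnramifiedIn` and
  `exists_mem_inertia_absRestrictNormalHom_ne_one`, `ArtinReciprocityCharacterFiniteProofs`);
* `isUnramifiedIn_of_le'` — unramified in `L` ⟹ unramified in every Galois `L' ≤ L`;
* `isUnramifiedIn_sup` — **unramified in `E₁` and in `E₂` ⟹ unramified in the compositum
  `E₁ E₂`** (Neukirch II (7.2)–(7.3) for the local statement; here globally, prime by prime: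
  `Gal(K̄/E₁E₂) = Gal(K̄/E₁) ∩ Gal(K̄/E₂)`, Mathlib `IntermediateField.fixingSubgroup_sup`).

The occurrence served: in the proof of ACC+ Thm. 6.1.1 (§6.5.12, arXiv:1812.09999 p. 88) the
auxiliary set `V₀ ∪ V₁ ∪ V₂` of places is unramified in the Galois extension `E/F` (it is
`V`-split) and in the field `K(ζ_p)` cut out by `ρ̄` and `χ̄_p`; to run the finite-level
disjointness argument of `SplitPrimesDisjointness.lean` inside the compositum `E · K(ζ_p)` one
needs these places unramified there — this file.

## References

* [NeukirchANT1999] J. Neukirch, *Algebraic Number Theory* (1999), Ch. II (7.2)–(7.3) (composita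
  and subextensions of unramified extensions are unramified), Ch. VII §10, proof of (10.6).
* [ACCGHLNSTT2023] P. B. Allen et al., *Potential automorphy over CM fields*, Ann. of Math. (2)
  197 (2023), §6.5.12.
-/

noncomputable section

open NumberField IsDedekindDomain Field

open scoped Classical

namespace Literature.NumberTheory.NumberFields

open Literature.NumberTheory.GaloisRepresentations

universe u

variable {K : Type u} [Field K] [NumberField K]

omit [NumberField K] in
/-- `g|_L = 1` iff `g ∈ Γ_K` fixes `L ⊆ K̄` pointwise. [folklore] -/
theorem absRestrictNormalHom_eq_one_iff_forall_smul (L : IntermediateField K (AlgebraicClosure K))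
    [Normal K L] (g : absoluteGaloisGroup K) :
    absRestrictNormalHom L g = 1 ↔ ∀ x : L, g • (x : AlgebraicClosure K) = x := by
  have hr : ∀ x : L, ((absRestrictNormalHom L g x : L) : AlgebraicClosure K) =
      g • (x : AlgebraicClosure K) := fun x => AlgEquiv.restrictNormalHom_apply L _ x
  constructor
  · intro h x
    rw [← hr x, h, AlgEquiv.one_apply]
  · intro h
    ext x
    rw [hr x, AlgEquiv.one_apply]
    exact h x

/-- **`v` is unramified in the finite Galois `L ⊆ K̄` iff all inertia groups of `Γ_K` above `v`
die in `Gal(L/K)`** ("`𝔭` is ramified `⟺ I_𝔓 ≠ 1`", Neukirch VII §10, proof of (10.6); the two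
directions are the tree's `absRestrictNormalHom_eq_one_of_isUnramifiedIn` and
`exists_mem_inertia_absRestrictNormalHom_ne_one`). [cite: NeukirchANT1999, Ch. VII §10 Thm. (10.6)
(proof)] -/
theorem isUnramifiedIn_iff_forall_inertia_absRestrictNormalHom_eq_one
    (L : IntermediateField K (AlgebraicClosure K)) [FiniteDimensional K L] [IsGalois K L]
    (v : HeightOneSpectrum (𝓞 K)) :
    Algebra.IsUnramifiedIn (𝓞 L) v.asIdeal ↔ ∀ 𝔓 ∈ v.primesAbove,
      ∀ g ∈ 𝔓.inertia (absoluteGaloisGroup K), absRestrictNormalHom L g = 1 := by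
  haveI : NumberField L := NumberField.of_module_finite K L
  constructor
  · intro h 𝔓 h𝔓 g hg
    exact absRestrictNormalHom_eq_one_of_isUnramifiedIn L h h𝔓 hg
  · intro h
    by_contra hram
    obtain ⟨𝔓, h𝔓, g, hg, hne⟩ := exists_mem_inertia_absRestrictNormalHom_ne_one L hram
    exact hne (h 𝔓 h𝔓 g hg)

/-- **Unramified in `L` ⟹ unramified in every Galois subfield `L' ⊆ L`** (both inside `K̄`;
Neukirch II (7.3); cf. the tree's `ArtinLemma.isUnramifiedIn_intermediateField` for intermediate
fields OF `L`): an inertia element killing `L` kills `L'`. [cite: NeukirchANT1999, Ch. II (7.3)] -/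
theorem isUnramifiedIn_of_le' {L L' : IntermediateField K (AlgebraicClosure K)}
    [FiniteDimensional K L] [IsGalois K L] [FiniteDimensional K L'] [IsGalois K L'] (hle : L' ≤ L)
    {v : HeightOneSpectrum (𝓞 K)} (h : Algebra.IsUnramifiedIn (𝓞 L) v.asIdeal) :
    Algebra.IsUnramifiedIn (𝓞 L') v.asIdeal := by
  rw [isUnramifiedIn_iff_forall_inertia_absRestrictNormalHom_eq_one] at h ⊢
  intro 𝔓 h𝔓 g hg
  rw [absRestrictNormalHom_eq_one_iff_forall_smul]
  intro x
  exact (absRestrictNormalHom_eq_one_iff_forall_smul L g).mp (h 𝔓 h𝔓 g hg) ⟨x, hle x.2⟩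

/-- **Unramified in `E₁` and in `E₂` ⟹ unramified in the compositum `E₁ E₂`** for finite Galois
`E₁, E₂ ⊆ K̄` (Neukirch II (7.2): "the composite of unramified extensions is unramified"; here for
the global notion `Algebra.IsUnramifiedIn (𝓞 ·) v`, prime by prime): an inertia element of `Γ_K`
above `v` fixes `E₁` and `E₂` pointwise, hence fixes `E₁ E₂`
(Mathlib `IntermediateField.fixingSubgroup_sup`). [cite: NeukirchANT1999, Ch. II (7.2)] -/
theorem isUnramifiedIn_sup {E₁ E₂ : IntermediateField K (AlgebraicClosure K)}
    [FiniteDimensional K E₁] [IsGalois K E₁] [FiniteDimensional K E₂] [IsGalois K E₂]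
    {v : HeightOneSpectrum (𝓞 K)} (h₁ : Algebra.IsUnramifiedIn (𝓞 E₁) v.asIdeal)
    (h₂ : Algebra.IsUnramifiedIn (𝓞 E₂) v.asIdeal) :
    Algebra.IsUnramifiedIn (𝓞 (E₁ ⊔ E₂ : IntermediateField K (AlgebraicClosure K))) v.asIdeal := by
  haveI : IsGalois K (E₁ ⊔ E₂ : IntermediateField K (AlgebraicClosure K)) :=
    isGalois_iff.mpr ⟨inferInstance, inferInstance⟩
  rw [isUnramifiedIn_iff_forall_inertia_absRestrictNormalHom_eq_one] at h₁ h₂ ⊢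
  intro 𝔓 h𝔓 g hg
  have hg₁ := (absRestrictNormalHom_eq_one_iff_forall_smul E₁ g).mp (h₁ 𝔓 h𝔓 g hg)
  have hg₂ := (absRestrictNormalHom_eq_one_iff_forall_smul E₂ g).mp (h₂ 𝔓 h𝔓 g hg)
  -- `g` fixes `E₁` and `E₂`, hence `E₁ ⊔ E₂`
  have hmem₁ : absoluteGaloisGroup.toAlgEquiv K g ∈ E₁.fixingSubgroup :=
    (IntermediateField.mem_fixingSubgroup_iff _ _).mpr fun x hx => hg₁ ⟨x, hx⟩
  have hmem₂ : absoluteGaloisGroup.toAlgEquiv K g ∈ E₂.fixingSubgroup :=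
    (IntermediateField.mem_fixingSubgroup_iff _ _).mpr fun x hx => hg₂ ⟨x, hx⟩
  have hmem : absoluteGaloisGroup.toAlgEquiv K g ∈
      (E₁ ⊔ E₂ : IntermediateField K (AlgebraicClosure K)).fixingSubgroup := by
    rw [IntermediateField.fixingSubgroup_sup]
    exact Subgroup.mem_inf.mpr ⟨hmem₁, hmem₂⟩
  rw [absRestrictNormalHom_eq_one_iff_forall_smul]
  intro x
  exact (IntermediateField.mem_fixingSubgroup_iff _ _).mp hmem x x.2

end Literature.NumberTheory.NumberFields

end
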